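import Summits.CriticalPhenomena.Ising3DConformalLimit.Theorems.ReflectionTwinExistsContinuousLimitClusterPointNondegenerate
import Summits.CriticalPhenomena.Ising3DConformalLimit.Theorems.HyperoctahedralRPExistsScaleCovariantLimitFoldedCurrentUniquenessScaleRedundancy
import Summits.CriticalPhenomena.Ising3DConformalLimit.Theorems.HyperoctahedralRPExistsScaleCovariantLimitRegularityGivesPrecompact
import Summits.CriticalPhenomena.Ising3DConformalLimit.Theorems.HyperoctahedralRPExistsScaleCovariantLimitScaleCovariantOfTwoThree
import Summits.CriticalPhenomena.Ising3DConformalLimit.Theorems.EnergyNotSigmaSquaredMoebiusLimitExistsClusterPointScaling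
import Mathlib.Topology.Instances.RealVectorSpace
import HarnessLib

/-!
# F4' at order two, unconditionally: total disconnectedness of the two-point image forces EXACT two-point scale covariance
# of every cluster point (crux `ExistsScaleCovariantLimit`, item stmt-CriticalPhenomena-1981, line `folded-current-repulsion`; lead c18)

Route `HyperoctahedralRP` / `PositivityBegetsConformality` (sub-problem `CriticalPhenomena/Ising3DConformalLimit`). Item
stmt-CriticalPhenomena-4659 (`ClusterRigidity.ClusterSetTotallyDisconnected`, the line's stub F4') is cut by its birth skeleton
into `stub_twoPointImageTD` — the set `π₂ '' 𝒞` of two-point functions of the cluster points `𝒞` of the self-normalised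
critical `ℤ³` Ising correlators is totally disconnected in the pointwise topology — and a fibrewise statement. The birth card
rates `stub_twoPointImageTD` as "topology-level" (it "tolerates countably many `Δ_σ`"). This file proves, WITHOUT any
compactness input (no item 6150 / 5955), that it is a RIGIDITY statement:

* `isClusterPoint_dilate_pin` — **the cluster set is invariant under the re-pinned dilations**, unconditionally: if `S` is a
  cluster point of the pinned zoom (along `u_k → 0⁺`, all orders, locally uniformly off the diagonals) then for every `s > 0`
  so is `x ↦ S₂(0, s e₀)^{-n/2} · S_n(s x)` (along `u_k / s`). Inputs: the exact re-pinning identity `pz_scale`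
  (`pz n (δ/s) x = pz 2 δ (0, s e₀)^{-n/2} · pz n δ (s x)`), the unconditional positivity `S₂ > 0` of two-point cluster data
  (`ReflectionTwinExistsContinuousLimit.clusterPoint_nondeg_two`, log-convexity of the axis two-point function) and the
  automatic continuity of cluster points off the diagonals (`continuousOn_of_isClusterPoint`). (The tree had the dilation
  invariance only under the two-point law, `IsClusterPoint.dilate_sc`, with the renormalisation `t^{nΔ}`.)
* `twoPoint_mul_of_twoPointImageTD` — **`stub_twoPointImageTD` ⟹ `S₂(c x, c y) = S₂(0, c e₀) · S₂(x, y)` for every member `S`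
  of item 4659's set, every `c > 0` and every pair**: the path `c ↦ π₂(D_c S)` is continuous from `(0, ∞)` into the product
  topology and runs inside `π₂ '' 𝒞`, so its connected image is a point.
* `twoPoint_scaleCovariant_of_twoPointImageTD` — hence **every member of item 4659's set has an exactly scale-covariant
  two-point function, `S₂(c x, c y) = c^{-2Δ_S} S₂(x, y)` for some `Δ_S`** (the axis profile `c ↦ S₂(0, c e₀)` is continuous,
  positive and multiplicative on `(0,∞)`, hence a power: Cauchy's equation through `AddMonoidHom.map_real_smul`), and
  `clusterPoint_twoPoint_scaleCovariant_of_twoPointImageTD` (the same for every cluster point of the pinned zoom, on the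
  non-coincident pairs).

Reading (for item 4659's chain and the crux's planners): `stub_twoPointImageTD` does not "tolerate" cluster points with a
drifting or non-power two-point function — each cluster point is individually two-point scale covariant; with item 6150 it is
even full-filter convergence of the pinned two-point function (`twoPointImageTD_and_doubling_iff_pointwiseLimitTwo`, companion
file `…FoldedCurrentTwoPointImage.lean`). No definitions; no `sorry`.

References: H. Duminil-Copin, ICM 2022, §8.1 eq. (8.1)–(8.2) and §8.4 [DuminilCopinICM2022]; M. Aizenman, H. Duminil-Copin,
Ann. of Math. 194 (2021), Prop. 5.3 (axis log-convexity, through `clusterPoint_nondeg_two`) [AizenmanDuminilCopinAnnals2021].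
-/

noncomputable section

namespace Summit.CriticalPhenomena.Ising3DConformalLimit.Cruxes.ExistsScaleCovariantLimit.FoldedCurrentRepulsion

open Filter Set
open scoped Topology
open Literature.Probability.LatticeModels
open Summit.CriticalPhenomena.Ising3DConformalLimit.MoebiusLimitExistsOnlyInteraction
  (rhoPin IsClusterPoint rhoPin_pos smul_mapsTo_nonCoincident_sc)
open Summit.CriticalPhenomena.Ising3DConformalLimit.MoebiusLimitExistsNegative (clusterPoint_two_conv)
open Summit.CriticalPhenomena.Ising3DConformalLimit.ReflectionTwinExistsContinuousLimit (clusterPoint_nondeg_two)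
open Summit.CriticalPhenomena.Ising3DConformalLimit.ExistsScaleCovariantLimitNegative.Dyadic (pz_scale cfg0_mem smul_cfg01)
open Summit.CriticalPhenomena.Ising3DConformalLimit.PinnedClusterPoints (cfg01_mem clusterPoint_cfg01)
open Summit.CriticalPhenomena.Ising3DConformalLimit.Cruxes.ExistsScaleCovariantLimit.TwoHierarchies
  (continuousOn_of_isClusterPoint rhoStar_eq_rhoPin smul_cfg0)
open Uniqueness (zoom_subseq)

/-! ## §1 Bookkeeping: dilations of configurations -/

/-- If `x` is coincident then so is every dilate `t • x`, `t ≠ 0`. [folklore] -/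
theorem smul_not_mem_nonCoincident {t : ℝ} (ht : t ≠ 0) {n : ℕ} {x : Fin n → EuclideanSpace ℝ (Fin 3)}
    (hx : x ∉ NonCoincident 3 n) : (fun i => t • x i) ∉ NonCoincident 3 n := by
  intro h
  apply hx
  have h' := smul_mapsTo_nonCoincident_sc (inv_ne_zero ht) n h
  simp only [smul_smul, inv_mul_cancel₀ ht, one_smul] at h'
  exact h'

/-- The dilation map `x ↦ c • x` on configurations is continuous. [folklore] -/
theorem continuous_cfg_smul (c : ℝ) (n : ℕ) :
    Continuous fun x : Fin n → EuclideanSpace ℝ (Fin 3) => fun i => c • x i :=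
  continuous_pi fun i => (continuous_apply i).const_smul c

/-- For a fixed configuration `x`, the map `c ↦ c • x` is continuous. [folklore] -/
theorem continuous_smul_cfg {n : ℕ} (x : Fin n → EuclideanSpace ℝ (Fin 3)) :
    Continuous fun c : ℝ => fun i => c • x i :=
  continuous_pi fun _ => continuous_id.smul continuous_const

/-! ## §2 The cluster set is invariant under the re-pinned dilations (no compactness) -/

/-- A cluster point of the pinned zoom is a cluster point along a mesh sequence lying in `(0,1]`. [folklore] -/
theorem exists_seq_Ioc_of_isClusterPoint {S : CorrFamily 3} (hS : IsClusterPoint S) :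
    ∃ u : ℕ → ℝ, (∀ k, u k ∈ Set.Ioc (0:ℝ) 1) ∧ Tendsto u atTop (𝓝[>] (0:ℝ)) ∧
      ∀ n, TendstoLocallyUniformlyOn (fun k => rescaledCorrelator (criticalCorr 3) rhoPin n (u k)) (S n) atTop
        (NonCoincident 3 n) := by
  obtain ⟨u, hu, hconv⟩ := hS
  have hev : ∀ᶠ k in atTop, u k ∈ Set.Ioc (0:ℝ) 1 := hu.eventually (Ioc_mem_nhdsGT one_pos)
  obtain ⟨N, hN⟩ := eventually_atTop.1 hev
  refine ⟨fun k => u (k + N), fun k => hN _ (Nat.le_add_left N k), hu.comp (tendsto_add_atTop_nat N), fun n => ?_⟩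
  exact zoom_subseq (hconv n) (fun a b hab => by simpa using hab)

/-- **THE CLUSTER SET IS INVARIANT UNDER THE RE-PINNED DILATIONS (unconditionally).** If `S` is a cluster point of the pinned
critical zoom then, for every `s > 0`, so is `x ↦ S₂(0, s e₀)^{-n/2} S_n(s x)` — along the mesh sequence divided by `s`:
`pz n (u_k/s) x = pz 2 (u_k) (0, s e₀)^{-n/2} · pz n (u_k) (s x)` (`pz_scale`), the first factor converges to
`S₂(0, s e₀)^{-n/2}` because `S₂(0, s e₀) > 0` (`clusterPoint_nondeg_two`), the second to `S_n(s x)` locally uniformly.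
[cite: DuminilCopinICM2022, §8.1 eq. (8.1)–(8.2)] -/
theorem isClusterPoint_dilate_pin {S : CorrFamily 3} (hS : IsClusterPoint S) {s : ℝ} (hs : 0 < s) :
    IsClusterPoint (fun n x => (S 2 (![0, EuclideanSpace.single 0 s] : Fin 2 → EuclideanSpace ℝ (Fin 3))) ^ (-(n:ℝ) / 2) *
      S n (fun i => s • x i)) := by
  have hA : 0 < S 2 (![0, EuclideanSpace.single 0 s] : Fin 2 → EuclideanSpace ℝ (Fin 3)) :=
    clusterPoint_nondeg_two (clusterPoint_two_conv hS) _ (cfg0_mem hs.ne')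
  have hcont := continuousOn_of_isClusterPoint hS
  obtain ⟨u, hu1, hu, hconv⟩ := exists_seq_Ioc_of_isClusterPoint hS
  have hu0 : Tendsto u atTop (𝓝 0) := (tendsto_nhdsWithin_iff.1 hu).1
  have hu' : Tendsto (fun k => s⁻¹ * u k) atTop (𝓝[>] (0 : ℝ)) := by
    refine tendsto_nhdsWithin_iff.2 ⟨by simpa using hu0.const_mul s⁻¹, Eventually.of_forall fun k => ?_⟩
    exact Set.mem_Ioi.2 (mul_pos (inv_pos.2 hs) (hu1 k).1)
  refine ⟨fun k => s⁻¹ * u k, hu', fun n => ?_⟩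
  have hmaps := smul_mapsTo_nonCoincident_sc hs.ne' n
  have hgc := continuous_cfg_smul s n
  -- the zoom at the dilated configurations converges to `S ∘ dilation`
  have h1 := (hconv n).comp (fun x : Fin n → EuclideanSpace ℝ (Fin 3) => fun i => s • x i) hmaps hgc.continuousOn
  -- the re-pinning factors converge
  have hsc : Tendsto (fun k => rescaledCorrelator (criticalCorr 3) rhoPin 2 (u k)
      (![0, EuclideanSpace.single 0 s] : Fin 2 → EuclideanSpace ℝ (Fin 3))) atTop
      (𝓝 (S 2 (![0, EuclideanSpace.single 0 s] : Fin 2 → EuclideanSpace ℝ (Fin 3)))) :=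
    (hconv 2).tendsto_at (cfg0_mem hs.ne')
  have h2 : TendstoLocallyUniformlyOn (fun k (_ : Fin n → EuclideanSpace ℝ (Fin 3)) =>
      (rescaledCorrelator (criticalCorr 3) rhoPin 2 (u k)
        (![0, EuclideanSpace.single 0 s] : Fin 2 → EuclideanSpace ℝ (Fin 3))) ^ (-(n:ℝ) / 2))
      (fun _ => (S 2 (![0, EuclideanSpace.single 0 s] : Fin 2 → EuclideanSpace ℝ (Fin 3))) ^ (-(n:ℝ) / 2)) atTop
      (NonCoincident 3 n) :=
    ((hsc.rpow_const (Or.inl hA.ne')).tendstoUniformlyOn_const _).tendstoLocallyUniformlyOn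
  have h3 := h2.mul₀ h1 continuousOn_const ((hcont n).comp hgc.continuousOn hmaps)
  refine (h3.congr fun k => ?_)
  intro x _
  simp only [Pi.mul_apply, Function.comp_apply]
  rw [pz_scale hs (hu1 k).1 n x]

/-- Normalisation (zero off the non-coincident configurations) is preserved by the re-pinned dilations. [folklore] -/
theorem dilate_pin_normalised {S : CorrFamily 3} (hSn : ∀ n x, x ∉ NonCoincident 3 n → S n x = 0) {s : ℝ} (hs : 0 < s) :
    ∀ n x, x ∉ NonCoincident 3 n → (S 2 (![0, EuclideanSpace.single 0 s] : Fin 2 → EuclideanSpace ℝ (Fin 3))) ^ (-(n:ℝ) / 2) *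
      S n (fun i => s • x i) = 0 := by
  intro n x hx
  rw [hSn n _ (smul_not_mem_nonCoincident hs.ne' hx), mul_zero]

/-- Members of item 4659's set are cluster points of the pinned zoom (`ρ★ = ρ_pin`). [folklore] -/
theorem isClusterPoint_of_mem_clusterSet {S : CorrFamily 3}
    (hS : S ∈ {S : CorrFamily 3 | (∀ n x, x ∉ NonCoincident 3 n → S n x = 0) ∧
      ∃ u : ℕ → ℝ, (∀ k, u k ∈ Set.Ioc (0:ℝ) 1) ∧ Filter.Tendsto u Filter.atTop (nhds 0) ∧ ∀ n, TendstoLocallyUniformlyOn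
        (fun k => rescaledCorrelator (criticalCorr 3) (fun δ : ℝ => (criticalTwoPoint 3 (Pi.single 0 ⌊δ⁻¹⌋)) ^ (-(1/2:ℝ))) n (u k))
        (S n) Filter.atTop (NonCoincident 3 n)}) : IsClusterPoint S := by
  obtain ⟨_, u, hu1, hu0, hconv⟩ := hS
  refine ⟨u, tendsto_nhdsWithin_iff.2 ⟨hu0, Eventually.of_forall fun k => (hu1 k).1⟩, fun n => ?_⟩
  rw [← rhoStar_eq_rhoPin]
  exact hconv n

/-- A normalised cluster point of the pinned zoom is a member of item 4659's set. [folklore] -/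
theorem mem_clusterSet_of_isClusterPoint {S : CorrFamily 3} (hS : IsClusterPoint S)
    (hSn : ∀ n x, x ∉ NonCoincident 3 n → S n x = 0) :
    S ∈ {S : CorrFamily 3 | (∀ n x, x ∉ NonCoincident 3 n → S n x = 0) ∧
      ∃ u : ℕ → ℝ, (∀ k, u k ∈ Set.Ioc (0:ℝ) 1) ∧ Filter.Tendsto u Filter.atTop (nhds 0) ∧ ∀ n, TendstoLocallyUniformlyOn
        (fun k => rescaledCorrelator (criticalCorr 3) (fun δ : ℝ => (criticalTwoPoint 3 (Pi.single 0 ⌊δ⁻¹⌋)) ^ (-(1/2:ℝ))) n (u k))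
        (S n) Filter.atTop (NonCoincident 3 n)} := by
  obtain ⟨u, hu1, hu, hconv⟩ := exists_seq_Ioc_of_isClusterPoint hS
  refine ⟨hSn, u, hu1, (tendsto_nhdsWithin_iff.1 hu).1, fun n => ?_⟩
  rw [rhoStar_eq_rhoPin]
  exact hconv n

/-! ## §3 Total disconnectedness of the two-point image ⟹ two-point scale covariance of every cluster point -/

/-- **`stub_twoPointImageTD` ⟹ `S₂(c x, c y) = S₂(0, c e₀) · S₂(x, y)`** for every member `S` of item 4659's set, every `c > 0`
and every pair: the path `c ↦ π₂(D_c S)`, `D_c S = S₂(0, c e₀)^{-n/2} S_n(c ·)`, is continuous from `(0,∞)` into the product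
topology (continuity of `S₂` off the diagonal, `continuousOn_of_isClusterPoint`; `S₂ = 0` on it) and takes values in the
totally disconnected set `π₂ '' 𝒞` (`isClusterPoint_dilate_pin`), so it is constant, equal to its value `S₂` at `c = 1`
(`S₂(0, e₀) = 1`, `clusterPoint_cfg01`). [folklore] -/
theorem twoPoint_mul_of_twoPointImageTD
    (htd : IsTotallyDisconnected ((fun S : CorrFamily 3 => S 2) '' {S : CorrFamily 3 | (∀ n x, x ∉ NonCoincident 3 n → S n x = 0) ∧
      ∃ u : ℕ → ℝ, (∀ k, u k ∈ Set.Ioc (0:ℝ) 1) ∧ Filter.Tendsto u Filter.atTop (nhds 0) ∧ ∀ n, TendstoLocallyUniformlyOn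
        (fun k => rescaledCorrelator (criticalCorr 3) (fun δ : ℝ => (criticalTwoPoint 3 (Pi.single 0 ⌊δ⁻¹⌋)) ^ (-(1/2:ℝ))) n (u k))
        (S n) Filter.atTop (NonCoincident 3 n)}))
    {S : CorrFamily 3}
    (hS : S ∈ {S : CorrFamily 3 | (∀ n x, x ∉ NonCoincident 3 n → S n x = 0) ∧
      ∃ u : ℕ → ℝ, (∀ k, u k ∈ Set.Ioc (0:ℝ) 1) ∧ Filter.Tendsto u Filter.atTop (nhds 0) ∧ ∀ n, TendstoLocallyUniformlyOn
        (fun k => rescaledCorrelator (criticalCorr 3) (fun δ : ℝ => (criticalTwoPoint 3 (Pi.single 0 ⌊δ⁻¹⌋)) ^ (-(1/2:ℝ))) n (u k))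
        (S n) Filter.atTop (NonCoincident 3 n)})
    {c : ℝ} (hc : 0 < c) (x : Fin 2 → EuclideanSpace ℝ (Fin 3)) :
    S 2 (fun i => c • x i) = S 2 (![0, EuclideanSpace.single 0 c] : Fin 2 → EuclideanSpace ℝ (Fin 3)) * S 2 x := by
  have hSn : ∀ n x, x ∉ NonCoincident 3 n → S n x = 0 := hS.1
  have hcp : IsClusterPoint S := isClusterPoint_of_mem_clusterSet hS
  have hcont2 : ContinuousOn (S 2) (NonCoincident 3 2) := continuousOn_of_isClusterPoint hcp 2
  -- the axis profile `ψ s = S₂(0, s e₀)`: positive on `(0,∞)`, `ψ 1 = 1`, continuous on `(0,∞)`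
  set ψ : ℝ → ℝ := fun s => S 2 (![0, EuclideanSpace.single 0 s] : Fin 2 → EuclideanSpace ℝ (Fin 3)) with hψ
  have hψpos : ∀ {s : ℝ}, 0 < s → 0 < ψ s := fun {s} hs =>
    clusterPoint_nondeg_two (clusterPoint_two_conv hcp) _ (cfg0_mem hs.ne')
  have hψ1 : ψ 1 = 1 := clusterPoint_cfg01 hcp
  have hψcont : ContinuousOn ψ (Set.Ioi 0) := by
    have h := hcont2.comp (continuous_smul_cfg (![0, EuclideanSpace.single 0 1] : Fin 2 → EuclideanSpace ℝ (Fin 3))).continuousOn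
      (fun s (hs : s ∈ Set.Ioi (0:ℝ)) => smul_mapsTo_nonCoincident_sc (ne_of_gt hs) 2 cfg01_mem)
    refine h.congr fun s _ => ?_
    simp only [hψ, Function.comp_apply, smul_cfg01]
  -- the path `γ s = π₂ (D_s S)`
  set γ : ℝ → ((Fin 2 → EuclideanSpace ℝ (Fin 3)) → ℝ) :=
    fun s y => (ψ s) ^ (-((2:ℕ):ℝ) / 2) * S 2 (fun i => s • y i) with hγ
  -- (a) its values over `(0,∞)` lie in the two-point image of item 4659's set
  have hγmem : ∀ {s : ℝ}, 0 < s → γ s ∈ (fun S : CorrFamily 3 => S 2) '' {S : CorrFamily 3 | (∀ n x, x ∉ NonCoincident 3 n → S n x = 0) ∧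
      ∃ u : ℕ → ℝ, (∀ k, u k ∈ Set.Ioc (0:ℝ) 1) ∧ Filter.Tendsto u Filter.atTop (nhds 0) ∧ ∀ n, TendstoLocallyUniformlyOn
        (fun k => rescaledCorrelator (criticalCorr 3) (fun δ : ℝ => (criticalTwoPoint 3 (Pi.single 0 ⌊δ⁻¹⌋)) ^ (-(1/2:ℝ))) n (u k))
        (S n) Filter.atTop (NonCoincident 3 n)} := by
    intro s hs
    exact ⟨_, mem_clusterSet_of_isClusterPoint (isClusterPoint_dilate_pin hcp hs) (dilate_pin_normalised hSn hs), rfl⟩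
  -- (b) it is continuous on `(0,∞)` into the product topology
  have hγcont : ContinuousOn γ (Set.Ioi 0) := by
    refine continuousOn_pi.2 fun y => ?_
    have hfac : ContinuousOn (fun s : ℝ => (ψ s) ^ (-((2:ℕ):ℝ) / 2)) (Set.Ioi 0) :=
      hψcont.rpow_const fun s hs => Or.inl (hψpos hs).ne'
    by_cases hy : y ∈ NonCoincident 3 2
    · have hsec : ContinuousOn (fun s : ℝ => S 2 (fun i => s • y i)) (Set.Ioi 0) :=
        hcont2.comp (continuous_smul_cfg y).continuousOn
          (fun s (hs : s ∈ Set.Ioi (0:ℝ)) => smul_mapsTo_nonCoincident_sc (ne_of_gt hs) 2 hy)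
      exact hfac.mul hsec
    · have hsec : ContinuousOn (fun s : ℝ => S 2 (fun i => s • y i)) (Set.Ioi 0) :=
        (continuousOn_const (c := (0:ℝ))).congr fun s (hs : s ∈ Set.Ioi (0:ℝ)) =>
          hSn 2 _ (smul_not_mem_nonCoincident (ne_of_gt hs) hy)
      exact hfac.mul hsec
  -- (c) hence its image of `(0,∞)` is a connected subset of a totally disconnected set: a point
  have hsub : (γ '' Set.Ioi 0).Subsingleton :=
    htd _ (by rintro _ ⟨s, hs, rfl⟩; exact hγmem hs) (isPreconnected_Ioi.image γ hγcont)
  have hγc : γ c = γ 1 := hsub ⟨c, Set.mem_Ioi.2 hc, rfl⟩ ⟨1, Set.mem_Ioi.2 one_pos, rfl⟩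
  -- (d) read off at the configuration `x`
  have hx : (ψ c) ^ (-((2:ℕ):ℝ) / 2) * S 2 (fun i => c • x i) =
      (ψ 1) ^ (-((2:ℕ):ℝ) / 2) * S 2 (fun i => (1:ℝ) • x i) := congr_fun hγc x
  have hexp : (-((2:ℕ):ℝ) / 2) = -1 := by norm_num
  simp only [hψ1, one_smul, hexp, Real.rpow_neg_one, inv_one, one_mul] at hx
  have hψc : ψ c ≠ 0 := (hψpos hc).ne'
  calc S 2 (fun i => c • x i) = ψ c * ((ψ c)⁻¹ * S 2 (fun i => c • x i)) := by
        rw [← mul_assoc, mul_inv_cancel₀ hψc, one_mul]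
    _ = ψ c * S 2 x := by rw [hx]

/-- **`stub_twoPointImageTD` ⟹ EVERY MEMBER OF ITEM 4659's SET HAS AN EXACTLY SCALE-COVARIANT TWO-POINT FUNCTION**:
`S₂(c x, c y) = c^{-2Δ_S} S₂(x, y)` for some `Δ_S ∈ ℝ`, all `c > 0` and all pairs. The axis profile `ψ(c) = S₂(0, c e₀)` is
positive, continuous and (by `twoPoint_mul_of_twoPointImageTD` at the pair `(0, s e₀)`) multiplicative on `(0,∞)`, so
`t ↦ log ψ(eᵗ)` is a continuous additive map `ℝ → ℝ`, hence linear (`AddMonoidHom.map_real_smul`), and `ψ(c) = c^{a}`.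
[folklore] -/
theorem twoPoint_scaleCovariant_of_twoPointImageTD
    (htd : IsTotallyDisconnected ((fun S : CorrFamily 3 => S 2) '' {S : CorrFamily 3 | (∀ n x, x ∉ NonCoincident 3 n → S n x = 0) ∧
      ∃ u : ℕ → ℝ, (∀ k, u k ∈ Set.Ioc (0:ℝ) 1) ∧ Filter.Tendsto u Filter.atTop (nhds 0) ∧ ∀ n, TendstoLocallyUniformlyOn
        (fun k => rescaledCorrelator (criticalCorr 3) (fun δ : ℝ => (criticalTwoPoint 3 (Pi.single 0 ⌊δ⁻¹⌋)) ^ (-(1/2:ℝ))) n (u k))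
        (S n) Filter.atTop (NonCoincident 3 n)})) :
    ∀ S ∈ {S : CorrFamily 3 | (∀ n x, x ∉ NonCoincident 3 n → S n x = 0) ∧
      ∃ u : ℕ → ℝ, (∀ k, u k ∈ Set.Ioc (0:ℝ) 1) ∧ Filter.Tendsto u Filter.atTop (nhds 0) ∧ ∀ n, TendstoLocallyUniformlyOn
        (fun k => rescaledCorrelator (criticalCorr 3) (fun δ : ℝ => (criticalTwoPoint 3 (Pi.single 0 ⌊δ⁻¹⌋)) ^ (-(1/2:ℝ))) n (u k))
        (S n) Filter.atTop (NonCoincident 3 n)},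
      ∃ Δ : ℝ, ∀ c : ℝ, 0 < c → ∀ x : Fin 2 → EuclideanSpace ℝ (Fin 3),
        S 2 (fun i => c • x i) = c ^ (-(2:ℝ) * Δ) * S 2 x := by
  intro S hS
  have hcp : IsClusterPoint S := isClusterPoint_of_mem_clusterSet hS
  have hcont2 : ContinuousOn (S 2) (NonCoincident 3 2) := continuousOn_of_isClusterPoint hcp 2
  have hmul := fun {c : ℝ} (hc : 0 < c) => twoPoint_mul_of_twoPointImageTD htd hS hc
  set ψ : ℝ → ℝ := fun s => S 2 (![0, EuclideanSpace.single 0 s] : Fin 2 → EuclideanSpace ℝ (Fin 3)) with hψ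
  have hψpos : ∀ {s : ℝ}, 0 < s → 0 < ψ s := fun {s} hs =>
    clusterPoint_nondeg_two (clusterPoint_two_conv hcp) _ (cfg0_mem hs.ne')
  have hψ1 : ψ 1 = 1 := clusterPoint_cfg01 hcp
  have hψcont : ContinuousOn ψ (Set.Ioi 0) := by
    have h := hcont2.comp (continuous_smul_cfg (![0, EuclideanSpace.single 0 1] : Fin 2 → EuclideanSpace ℝ (Fin 3))).continuousOn
      (fun s (hs : s ∈ Set.Ioi (0:ℝ)) => smul_mapsTo_nonCoincident_sc (ne_of_gt hs) 2 cfg01_mem)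
    refine h.congr fun s _ => ?_
    simp only [hψ, Function.comp_apply, smul_cfg01]
  -- multiplicativity of the axis profile
  have hψmul : ∀ {a b : ℝ}, 0 < a → 0 < b → ψ (a * b) = ψ a * ψ b := by
    intro a b ha hb
    have h := hmul ha (![0, EuclideanSpace.single 0 b] : Fin 2 → EuclideanSpace ℝ (Fin 3))
    rw [smul_cfg0] at h
    exact h
  -- Cauchy's equation for `t ↦ log ψ (exp t)`
  set φ : ℝ →+ ℝ :=
    { toFun := fun t => Real.log (ψ (Real.exp t))
      map_zero' := by
        show Real.log (ψ (Real.exp 0)) = 0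
        rw [Real.exp_zero, hψ1, Real.log_one]
      map_add' := fun a b => by
        show Real.log (ψ (Real.exp (a + b))) = Real.log (ψ (Real.exp a)) + Real.log (ψ (Real.exp b))
        rw [Real.exp_add, hψmul (Real.exp_pos a) (Real.exp_pos b),
          Real.log_mul (hψpos (Real.exp_pos a)).ne' (hψpos (Real.exp_pos b)).ne'] } with hφ
  have hφcont : Continuous φ := by
    have h1 : Continuous fun t : ℝ => ψ (Real.exp t) :=
      hψcont.comp_continuous Real.continuous_exp fun t => Real.exp_pos t
    have h2 : Continuous fun t : ℝ => Real.log (ψ (Real.exp t)) :=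
      Real.continuousOn_log.comp_continuous h1 fun t => (hψpos (Real.exp_pos t)).ne'
    exact h2
  have hφlin : ∀ t : ℝ, φ t = t * φ 1 := by
    intro t
    have h := map_real_smul φ hφcont t 1
    rw [smul_eq_mul, mul_one, smul_eq_mul] at h
    exact h
  -- the power law of the axis profile
  have hψpow : ∀ {c : ℝ}, 0 < c → ψ c = c ^ (φ 1) := by
    intro c hc
    have h := hφlin (Real.log c)
    have h' : φ (Real.log c) = Real.log (ψ (Real.exp (Real.log c))) := rfl
    rw [Real.exp_log hc] at h'
    rw [Real.rpow_def_of_pos hc, ← h, h', Real.exp_log (hψpos hc)]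
  refine ⟨-(φ 1) / 2, fun c hc x => ?_⟩
  rw [hmul hc x, show S 2 (![0, EuclideanSpace.single 0 c] : Fin 2 → EuclideanSpace ℝ (Fin 3)) = c ^ (φ 1) from hψpow hc]
  have hexp : (-(2:ℝ)) * (-(φ 1) / 2) = φ 1 := by ring
  rw [hexp]

/-- **The same for every cluster point of the pinned zoom** (not necessarily normalised), on the non-coincident pairs:
under `stub_twoPointImageTD`, `S₂(c x, c y) = c^{-2Δ_S} S₂(x, y)` for `x ≠ y`, `c > 0`. [folklore] -/
theorem clusterPoint_twoPoint_scaleCovariant_of_twoPointImageTD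
    (htd : IsTotallyDisconnected ((fun S : CorrFamily 3 => S 2) '' {S : CorrFamily 3 | (∀ n x, x ∉ NonCoincident 3 n → S n x = 0) ∧
      ∃ u : ℕ → ℝ, (∀ k, u k ∈ Set.Ioc (0:ℝ) 1) ∧ Filter.Tendsto u Filter.atTop (nhds 0) ∧ ∀ n, TendstoLocallyUniformlyOn
        (fun k => rescaledCorrelator (criticalCorr 3) (fun δ : ℝ => (criticalTwoPoint 3 (Pi.single 0 ⌊δ⁻¹⌋)) ^ (-(1/2:ℝ))) n (u k))
        (S n) Filter.atTop (NonCoincident 3 n)}))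
    {S : CorrFamily 3} (hS : IsClusterPoint S) :
    ∃ Δ : ℝ, ∀ c : ℝ, 0 < c → ∀ x ∈ NonCoincident 3 2, S 2 (fun i => c • x i) = c ^ (-(2:ℝ) * Δ) * S 2 x := by
  classical
  -- normalise `S` off the non-coincident configurations
  set T : CorrFamily 3 := fun n x => if x ∈ NonCoincident 3 n then S n x else 0 with hT
  have hTn : ∀ n x, x ∉ NonCoincident 3 n → T n x = 0 := fun n x hx => by simp only [hT, if_neg hx]
  have hTeq : ∀ n, Set.EqOn (T n) (S n) (NonCoincident 3 n) := fun n x hx => by simp only [hT, if_pos hx]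
  have hTcp : IsClusterPoint T := by
    obtain ⟨u, hu, hconv⟩ := hS
    exact ⟨u, hu, fun n => (hconv n).congr_right (hTeq n).symm⟩
  obtain ⟨Δ, hΔ⟩ := twoPoint_scaleCovariant_of_twoPointImageTD htd T (mem_clusterSet_of_isClusterPoint hTcp hTn)
  refine ⟨Δ, fun c hc x hx => ?_⟩
  have h := hΔ c hc x
  rwa [hTeq 2 (smul_mapsTo_nonCoincident_sc hc.ne' 2 hx), hTeq 2 hx] at h

end Summit.CriticalPhenomena.Ising3DConformalLimit.Cruxes.ExistsScaleCovariantLimit.FoldedCurrentRepulsion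

end
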